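import Summits.Ventures.PercRepro.Night2SeriesClassesThreeOneCellsB

/-!
# PercRepro — the explicit series-class cells of `(3, 1)`, part C: `|G| = 17` (night-2, gen 23)

Per `|G| = 11 … 17`: the `K₄` cell (`…_of_K4`) and the triangle-plus-disjoint-pair cell (`…_of_trianglePair`) at every
size, the triangle cell (`…_of_triangle`) at `|G| = 11, 16, 17`, the two-disjoint-pairs cell (`…_of_twoPairs`) at
`|G| = 16, 17` — the generic cells of `Night2SeriesClassesThreeOne` with the count sums of
`Night2SeriesClassesThreeOneSums`; the points are required not to be coloops (the fat missed pairs avoid `K`).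
-/

namespace PercRepro.Shadow

open Finset PerFlat ThmH

variable {α : Type*} [DecidableEq α] {M : Matroid α} [M.Finite]

open scoped Classical in
/-- **The `K₄` cell of `(3, 1)` at `|G| = 17`**: four points, none a coloop, with all six pairs 2-cocircuits. -/
theorem localShadowHall_three_one_five_seventeen_of_K4 {G : Finset α} (hG : G ∈ flatsQ M (5 + 1))
    (hd : (gr M \ G).card = 3) (hk : kColoops M G = 1)
    (hs : ∀ e ∈ gr M, ∀ f ∈ gr M, e ≠ f → rkN M {e, f} = 2) (hl : ∀ e ∈ gr M, M.Indep {e})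
    (hn : G.card = 17) {p x y z : α} (hpx : p ≠ x) (hpy : p ≠ y) (hpz : p ≠ z) (hxy : x ≠ y) (hxz : x ≠ z)
    (hyz : y ≠ z) (hK : ∀ a ∈ ({p, x, y, z} : Finset α), a ∉ coloops M G)
    (hcoc : ∀ a ∈ ({p, x, y, z} : Finset α), ∀ b ∈ ({p, x, y, z} : Finset α), a ≠ b →
      M.eRk ((G \ {a, b} : Finset α) : Set α) ≤ ((5 : ℕ) : ℕ∞)) :
    LocalShadowHall M 5 G := by
  have hKe : ∀ {a b : α}, a ∉ coloops M G → b ∉ coloops M G → coloops M G ⊆ G \ {a, b} := by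
    intro a b ha hb z hz
    rw [Finset.mem_sdiff]
    refine ⟨(mem_coloops.1 hz).1, ?_⟩
    simp only [Finset.mem_insert, Finset.mem_singleton]
    rintro (rfl | rfl)
    · exact ha hz
    · exact hb hz
  have hc4 : ({p, x, y, z} : Finset α).card = 4 := by
    rw [Finset.card_insert_of_notMem (by simp [hpx, hpy, hpz]), Finset.card_insert_of_notMem (by simp [hxy, hxz]),
      Finset.card_pair hyz]
  refine localShadowHall_three_one_five_seventeen_of_classes hG hd hk hs hl hn [({p, x, y, z} : Finset α)]
    (List.pairwise_singleton _ _) ?_ ?_ ?_ ?_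
  · intro C hC
    rw [List.mem_singleton] at hC
    rw [hC, hc4]; omega
  · intro C hC a ha b hb hab
    rw [List.mem_singleton] at hC
    rw [hC] at ha hb
    exact ⟨hKe (hK a ha) (hK b hb), hcoc a ha b hb hab⟩
  · simp only [List.map_cons, List.map_nil, hc4]
    intro s h1 h2
    exact cntSeries_five_4_pos s h1 (by omega)
  · simp only [List.map_cons, List.map_nil, hc4]
    exact countSum_three_one_sixteen_4

open scoped Classical in
/-- **The triangle-plus-pair cell of `(3, 1)` at `|G| = 17`**: a triangle of 2-cocircuits and a disjoint 2-cocircuit,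
no point a coloop. -/
theorem localShadowHall_three_one_five_seventeen_of_trianglePair {G : Finset α} (hG : G ∈ flatsQ M (5 + 1))
    (hd : (gr M \ G).card = 3) (hk : kColoops M G = 1)
    (hs : ∀ e ∈ gr M, ∀ f ∈ gr M, e ≠ f → rkN M {e, f} = 2) (hl : ∀ e ∈ gr M, M.Indep {e})
    (hn : G.card = 17) {p x y u v : α} (hpx : p ≠ x) (hpy : p ≠ y) (hxy : x ≠ y) (huv : u ≠ v)
    (hdisj : Disjoint ({p, x, y} : Finset α) {u, v})
    (hK : ∀ a ∈ ({p, x, y, u, v} : Finset α), a ∉ coloops M G)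
    (hH₀ : M.eRk ((G \ {p, x} : Finset α) : Set α) ≤ ((5 : ℕ) : ℕ∞))
    (hH₁ : M.eRk ((G \ {p, y} : Finset α) : Set α) ≤ ((5 : ℕ) : ℕ∞))
    (hH₂ : M.eRk ((G \ {x, y} : Finset α) : Set α) ≤ ((5 : ℕ) : ℕ∞))
    (hH₃ : M.eRk ((G \ {u, v} : Finset α) : Set α) ≤ ((5 : ℕ) : ℕ∞)) :
    LocalShadowHall M 5 G := by
  have hKe : ∀ {a b : α}, a ∉ coloops M G → b ∉ coloops M G → coloops M G ⊆ G \ {a, b} := by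
    intro a b ha hb z hz
    rw [Finset.mem_sdiff]
    refine ⟨(mem_coloops.1 hz).1, ?_⟩
    simp only [Finset.mem_insert, Finset.mem_singleton]
    rintro (rfl | rfl)
    · exact ha hz
    · exact hb hz
  have hc3 : ({p, x, y} : Finset α).card = 3 := by
    rw [Finset.card_insert_of_notMem (by simp [hpx, hpy]), Finset.card_pair hxy]
  have hc2 : ({u, v} : Finset α).card = 2 := Finset.card_pair huv
  have hKT : ∀ a ∈ ({p, x, y} : Finset α), a ∉ coloops M G := by
    intro a ha; apply hK; simp only [Finset.mem_insert, Finset.mem_singleton] at ha ⊢; tauto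
  have hKQ : ∀ a ∈ ({u, v} : Finset α), a ∉ coloops M G := by
    intro a ha; apply hK; simp only [Finset.mem_insert, Finset.mem_singleton] at ha ⊢; tauto
  refine localShadowHall_three_one_five_seventeen_of_classes hG hd hk hs hl hn [({p, x, y} : Finset α), {u, v}]
    ?_ ?_ ?_ ?_ ?_
  · rw [List.pairwise_cons]
    refine ⟨?_, List.pairwise_singleton _ _⟩
    intro C hC
    rw [List.mem_singleton] at hC
    rw [hC]; exact hdisj
  · intro C hC
    simp only [List.mem_cons, List.not_mem_nil, or_false] at hC
    rcases hC with rfl | rfl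
    · rw [hc3]; omega
    · rw [hc2]; omega
  · intro C hC a ha b hb hab
    simp only [List.mem_cons, List.not_mem_nil, or_false] at hC
    rcases hC with rfl | rfl
    · exact ⟨hKe (hKT a ha) (hKT b hb), triangle_cocircuits hH₀ hH₁ hH₂ a ha b hb hab⟩
    · refine ⟨hKe (hKQ a ha) (hKQ b hb), ?_⟩
      simp only [Finset.mem_insert, Finset.mem_singleton] at ha hb
      rcases ha with rfl | rfl <;> rcases hb with rfl | rfl
      · exact absurd rfl hab
      · exact hH₃
      · rwa [Finset.pair_comm]
      · exact absurd rfl hab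
  · simp only [List.map_cons, List.map_nil, hc3, hc2]
    intro s h1 h2
    exact cntSeries_five_32_pos s h1 (by omega)
  · simp only [List.map_cons, List.map_nil, hc3, hc2]
    exact countSum_three_one_sixteen_32

open scoped Classical in
/-- **The triangle cell of `(3, 1)` at `|G| = 17`**: a triangle of 2-cocircuits, no point a coloop. -/
theorem localShadowHall_three_one_five_seventeen_of_triangle {G : Finset α} (hG : G ∈ flatsQ M (5 + 1))
    (hd : (gr M \ G).card = 3) (hk : kColoops M G = 1)
    (hs : ∀ e ∈ gr M, ∀ f ∈ gr M, e ≠ f → rkN M {e, f} = 2) (hl : ∀ e ∈ gr M, M.Indep {e})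
    (hn : G.card = 17) {p x y : α} (hpx : p ≠ x) (hpy : p ≠ y) (hxy : x ≠ y)
    (hK : ∀ a ∈ ({p, x, y} : Finset α), a ∉ coloops M G)
    (hH₀ : M.eRk ((G \ {p, x} : Finset α) : Set α) ≤ ((5 : ℕ) : ℕ∞))
    (hH₁ : M.eRk ((G \ {p, y} : Finset α) : Set α) ≤ ((5 : ℕ) : ℕ∞))
    (hH₂ : M.eRk ((G \ {x, y} : Finset α) : Set α) ≤ ((5 : ℕ) : ℕ∞)) :
    LocalShadowHall M 5 G := by
  have hKe : ∀ {a b : α}, a ∉ coloops M G → b ∉ coloops M G → coloops M G ⊆ G \ {a, b} := by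
    intro a b ha hb z hz
    rw [Finset.mem_sdiff]
    refine ⟨(mem_coloops.1 hz).1, ?_⟩
    simp only [Finset.mem_insert, Finset.mem_singleton]
    rintro (rfl | rfl)
    · exact ha hz
    · exact hb hz
  have hc3 : ({p, x, y} : Finset α).card = 3 := by
    rw [Finset.card_insert_of_notMem (by simp [hpx, hpy]), Finset.card_pair hxy]
  refine localShadowHall_three_one_five_seventeen_of_classes hG hd hk hs hl hn [({p, x, y} : Finset α)]
    (List.pairwise_singleton _ _) ?_ ?_ ?_ ?_
  · intro C hC
    rw [List.mem_singleton] at hC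
    rw [hC, hc3]; omega
  · intro C hC a ha b hb hab
    rw [List.mem_singleton] at hC
    rw [hC] at ha hb
    exact ⟨hKe (hK a ha) (hK b hb), triangle_cocircuits hH₀ hH₁ hH₂ a ha b hb hab⟩
  · simp only [List.map_cons, List.map_nil, hc3]
    intro s h1 h2
    exact cntSeries_five_3_pos s h1 (by omega)
  · simp only [List.map_cons, List.map_nil, hc3]
    exact countSum_three_one_sixteen_3

open scoped Classical in
/-- **The two-disjoint-pairs cell of `(3, 1)` at `|G| = 17`**: two disjoint 2-cocircuits, no point a coloop. -/
theorem localShadowHall_three_one_five_seventeen_of_twoPairs {G : Finset α} (hG : G ∈ flatsQ M (5 + 1))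
    (hd : (gr M \ G).card = 3) (hk : kColoops M G = 1)
    (hs : ∀ e ∈ gr M, ∀ f ∈ gr M, e ≠ f → rkN M {e, f} = 2) (hl : ∀ e ∈ gr M, M.Indep {e})
    (hn : G.card = 17) {p x u v : α} (hpx : p ≠ x) (huv : u ≠ v)
    (hdisj : Disjoint ({p, x} : Finset α) {u, v})
    (hK : ∀ a ∈ ({p, x, u, v} : Finset α), a ∉ coloops M G)
    (hH₀ : M.eRk ((G \ {p, x} : Finset α) : Set α) ≤ ((5 : ℕ) : ℕ∞))
    (hH₃ : M.eRk ((G \ {u, v} : Finset α) : Set α) ≤ ((5 : ℕ) : ℕ∞)) :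
    LocalShadowHall M 5 G := by
  have hKe : ∀ {a b : α}, a ∉ coloops M G → b ∉ coloops M G → coloops M G ⊆ G \ {a, b} := by
    intro a b ha hb z hz
    rw [Finset.mem_sdiff]
    refine ⟨(mem_coloops.1 hz).1, ?_⟩
    simp only [Finset.mem_insert, Finset.mem_singleton]
    rintro (rfl | rfl)
    · exact ha hz
    · exact hb hz
  have hc₁ : ({p, x} : Finset α).card = 2 := Finset.card_pair hpx
  have hc₂ : ({u, v} : Finset α).card = 2 := Finset.card_pair huv
  have hKP : ∀ a ∈ ({p, x} : Finset α), a ∉ coloops M G := by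
    intro a ha; apply hK; simp only [Finset.mem_insert, Finset.mem_singleton] at ha ⊢; tauto
  have hKQ : ∀ a ∈ ({u, v} : Finset α), a ∉ coloops M G := by
    intro a ha; apply hK; simp only [Finset.mem_insert, Finset.mem_singleton] at ha ⊢; tauto
  have pairc : ∀ {a b : α}, M.eRk ((G \ {a, b} : Finset α) : Set α) ≤ ((5 : ℕ) : ℕ∞) →
      ∀ c ∈ ({a, b} : Finset α), ∀ e ∈ ({a, b} : Finset α), c ≠ e →
        M.eRk ((G \ {c, e} : Finset α) : Set α) ≤ ((5 : ℕ) : ℕ∞) := by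
    intro a b h c hc e he hce
    simp only [Finset.mem_insert, Finset.mem_singleton] at hc he
    rcases hc with rfl | rfl <;> rcases he with rfl | rfl
    · exact absurd rfl hce
    · exact h
    · rwa [Finset.pair_comm]
    · exact absurd rfl hce
  refine localShadowHall_three_one_five_seventeen_of_classes hG hd hk hs hl hn [({p, x} : Finset α), {u, v}]
    ?_ ?_ ?_ ?_ ?_
  · rw [List.pairwise_cons]
    refine ⟨?_, List.pairwise_singleton _ _⟩
    intro C hC
    rw [List.mem_singleton] at hC
    rw [hC]; exact hdisj
  · intro C hC
    simp only [List.mem_cons, List.not_mem_nil, or_false] at hC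
    rcases hC with rfl | rfl
    · rw [hc₁]; omega
    · rw [hc₂]; omega
  · intro C hC a ha b hb hab
    simp only [List.mem_cons, List.not_mem_nil, or_false] at hC
    rcases hC with rfl | rfl
    · exact ⟨hKe (hKP a ha) (hKP b hb), pairc hH₀ a ha b hb hab⟩
    · exact ⟨hKe (hKQ a ha) (hKQ b hb), pairc hH₃ a ha b hb hab⟩
  · simp only [List.map_cons, List.map_nil, hc₁, hc₂]
    intro s h1 h2
    exact cntSeries_five_22_pos s h1 (by omega)
  · simp only [List.map_cons, List.map_nil, hc₁, hc₂]
    exact countSum_three_one_sixteen_22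

end PercRepro.Shadow
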